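import Mathlib
import Literature.Geometry.Lorentzian.ChartConnection
import Literature.Geometry.Lorentzian.ChartCalculus
import Literature.Geometry.Lorentzian.BoundedGeometry
import Literature.Geometry.Lorentzian.KerrSchild

/-!
# Route PhotonSphereChannels · crux `TameCensorship` (stmt-FinalStateConjecture-17431) · line `Sketch`,
# skeleton v6 · stub `stub_chartRiemannBound`: curvature components of a chart metric under the pin

Helper file (`--supports stmt-FinalStateConjecture-17431`) of line `Sketch` (lead c2, 2026-08-17), brick S17 of
the PANCAKE LAW (alternative route to clause (a) of K3, skeleton v6). With `G` the components of a smooth metric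
`g` on an open `U ⊆ E4 = EuclideanSpace ℝ (Fin 4)` (`g.val y = G y`), pinned at `x` to the Minkowski form
(`‖G x − η‖ ≤ ½`, `η = Minkowski.bilin`, operator norm of `E4 →L[ℝ] E4 →L[ℝ] ℝ`), with second derivatives
`‖D²G(x)(v, w)‖ ≤ L₂ ‖v‖ ‖w‖` and Christoffel map `‖Γ_x(Y₀)(X₀)‖ ≤ LΓ ‖Y₀‖ ‖X₀‖`, the paired curvature
components obey `|g_x(R(X₀,Y₀)Z₀, W₀)| ≤ (3 L₂ + 3 LΓ²) ‖X₀‖ ‖Y₀‖ ‖Z₀‖ ‖W₀‖`.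

The input is the first-kind coordinate formula `OpensChart.val_riemann_eq` (O'Neill 1983, Ch. 3, Lemma 3.38):
`g_x(R(X₀,Y₀)Z₀, W₀) = ½(∂_{X₀}K(Z₀,Y₀,W₀) − ∂_{Y₀}K(Z₀,X₀,W₀)) − g_x(Γ(Z₀)(Y₀), Γ(W₀)(X₀))
  + g_x(Γ(Z₀)(X₀), Γ(W₀)(Y₀))`
with the Koszul form `K(Z,Y,W)(y) = DG(y)(Y)(Z,W) + DG(y)(Z)(W,Y) − DG(y)(W)(Y,Z)`
(`OpensChart.koszulForm_apply`). Its derivative at `x` in direction `V` is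
`D²G(x)(V,Y)(Z,W) + D²G(x)(V,Z)(W,Y) − D²G(x)(V,W)(Y,Z)` (three terms, each `≤ L₂ ∏‖·‖`), and the two `ΓΓ`
pairings are `≤ ‖G x‖ LΓ² ∏‖·‖` with `‖G x‖ ≤ 3/2` (`Minkowski.norm_bilin_le_one`). Pure calculus on `E4`;
nothing here is specific to dimension `4`.

References: B. O'Neill, *Semi-Riemannian Geometry* (1983), Ch. 3, Prop. 3.13, Lemma 3.38.
-/

-- the problem namespace `Summit.FinalStateConjecture.FinalStateConjecture.…` repeats a component by design
set_option linter.dupNamespace false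
-- instance search through the nested operator type `E4 →L[ℝ] E4 →L[ℝ] ℝ` (as in the tree's chart files)
set_option maxSynthPendingDepth 3

open Literature.Geometry.Lorentzian
open scoped Manifold ContDiff Topology

noncomputable section

namespace Summit.FinalStateConjecture.FinalStateConjecture.Theorems.PhotonSphereChannels.TameCensorshipUnwind

/-- Derivative of a component of a field of trilinear forms: `∂_v (H(·)(a, b, c))(x) = DH(x)(v)(a, b, c)`
(evaluation is linear; `fderiv_clm_apply` three times). Used with `H = DG`. [folklore] -/
private theorem riemBd_fderiv_apply₃ {H : E4 → E4 →L[ℝ] E4 →L[ℝ] E4 →L[ℝ] ℝ} {x : E4}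
    (hH : DifferentiableAt ℝ H x) (a b c v : E4) :
    fderiv ℝ (fun y ↦ H y a b c) x v = fderiv ℝ H x v a b c := by
  have h1 : DifferentiableAt ℝ (fun y ↦ H y a) x := hH.clm_apply (differentiableAt_const a)
  have h2 : DifferentiableAt ℝ (fun y ↦ H y a b) x := h1.clm_apply (differentiableAt_const b)
  rw [fderiv_clm_apply h2 (differentiableAt_const c), fderiv_clm_apply h1 (differentiableAt_const b),
    fderiv_clm_apply hH (differentiableAt_const a)]
  simp only [fderiv_fun_const, Pi.zero_apply, ContinuousLinearMap.comp_zero, ContinuousLinearMap.flip_apply,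
    zero_add]

/-- Size of a component of the second derivative: `|D²G(x)(V)(W)(a, b)| ≤ L₂ ‖V‖ ‖W‖ ‖a‖ ‖b‖` when
`‖D²G(x)(V)(W)‖ ≤ L₂ ‖V‖ ‖W‖` (`ContinuousLinearMap.le_of_opNorm₂_le_of_le`). [folklore] -/
private theorem riemBd_abs_d2_le {G : E4 → E4 →L[ℝ] E4 →L[ℝ] ℝ} {x : E4} {L₂ : ℝ}
    (hL₂ : ∀ v w : E4, ‖fderiv ℝ (fderiv ℝ G) x v w‖ ≤ L₂ * ‖v‖ * ‖w‖) (V W a b : E4) :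
    |fderiv ℝ (fderiv ℝ G) x V W a b| ≤ L₂ * ‖V‖ * ‖W‖ * ‖a‖ * ‖b‖ := by
  rw [← Real.norm_eq_abs]
  exact (fderiv ℝ (fderiv ℝ G) x V W).le_of_opNorm₂_le_of_le (hL₂ V W) le_rfl le_rfl

/-- Elementary bookkeeping for `val_riemann_eq`: `|½(D₁ − D₂) − P₁ + P₂| ≤ a + 2b` when `|Dᵢ| ≤ a` and
`|Pᵢ| ≤ b`. [folklore] -/
private theorem riemBd_combine {D₁ D₂ P₁ P₂ a b : ℝ} (h₁ : |D₁| ≤ a) (h₂ : |D₂| ≤ a)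
    (h₃ : |P₁| ≤ b) (h₄ : |P₂| ≤ b) : |2⁻¹ * (D₁ - D₂) - P₁ + P₂| ≤ a + 2 * b := by
  have e₁ := abs_le.1 h₁
  have e₂ := abs_le.1 h₂
  have e₃ := abs_le.1 h₃
  have e₄ := abs_le.1 h₄
  rw [abs_le]
  constructor <;> linarith

/-- **Stub `stub_chartRiemannBound` of line `Sketch` (skeleton v6) for the crux
`PhotonSphereChannels.TameCensorship` (stmt-FinalStateConjecture-17431).** Curvature components of a chart metric
are bounded by two derivatives of the components and the Christoffel bound (O'Neill 1983, Ch. 3, Lemma 3.38 in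
the first-kind form `OpensChart.val_riemann_eq`): for a smooth metric `g` on `U : Opens E4` with components `G`
(`g.val y = G y`), at a point `x` with `‖G x − η‖ ≤ ½` (so `‖G x‖ ≤ 3/2`), `‖D²G(x)(v, w)‖ ≤ L₂ ‖v‖ ‖w‖` and
`‖Γ_x(Y₀)(X₀)‖ ≤ LΓ ‖Y₀‖ ‖X₀‖` (`LΓ ≥ 0`):
`|g_x(R(X₀,Y₀)Z₀, W₀)| ≤ (3 L₂ + 3 LΓ²) ‖X₀‖ ‖Y₀‖ ‖Z₀‖ ‖W₀‖`. Proof: the derivative of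
`y ↦ K(Z,Y,W)(y) = DG(y)(Y)(Z,W) + DG(y)(Z)(W,Y) − DG(y)(W)(Y,Z)` at `x` in direction `V` is
`D²G(x)(V,Y)(Z,W) + D²G(x)(V,Z)(W,Y) − D²G(x)(V,W)(Y,Z)` (`G` is smooth at `x`, `OpensChart.contDiffAt_repr`),
each term `≤ L₂ ∏‖·‖`, so the `½(∂K − ∂K)` part is `≤ 3 L₂ ∏‖·‖`; each `ΓΓ` pairing is
`≤ ‖G x‖ ‖Γ‖ ‖Γ‖ ≤ 3/2 · LΓ² ∏‖·‖`. [folklore; O'Neill 1983, Ch. 3, Lemma 3.38] -/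
theorem stub_chartRiemannBound :
    ∀ (U : TopologicalSpace.Opens E4)
    (g : PseudoRiemannianMetric 𝓘(ℝ, E4) ∞ E4 (TangentSpace 𝓘(ℝ, E4) : U → Type _)) [g.HasLeviCivita]
    (G : E4 → E4 →L[ℝ] E4 →L[ℝ] ℝ) (x : U) (L₂ LΓ : ℝ),
    (∀ y : U, g.val y = G y) → ‖G x - Minkowski.bilin‖ ≤ 1 / 2 →
    (∀ v w : E4, ‖fderiv ℝ (fderiv ℝ G) x v w‖ ≤ L₂ * ‖v‖ * ‖w‖) → 0 ≤ LΓ →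
    (∀ Y₀ X₀ : E4, ‖OpensChart.christoffel g G x Y₀ X₀‖ ≤ LΓ * ‖Y₀‖ * ‖X₀‖) →
    ∀ X₀ Y₀ Z₀ W₀ : E4,
      |g.val x (g.riemann x X₀ Y₀ Z₀) W₀| ≤ (3 * L₂ + 3 * LΓ ^ 2) * ‖X₀‖ * ‖Y₀‖ * ‖Z₀‖ * ‖W₀‖ := by
  intro U g _ G x L₂ LΓ hG hpin hL₂ _hLΓ hΓ X₀ Y₀ Z₀ W₀
  -- (0) regularity of the representative at `x`
  have h2i : (2 : ℕ∞ω) ≤ ∞ := WithTop.coe_le_coe.mpr le_top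
  have hG2 : ContDiffAt ℝ 2 G x := (OpensChart.contDiffAt_repr hG x).of_le h2i
  have hH : DifferentiableAt ℝ (fderiv ℝ G) x :=
    (hG2.fderiv_right (m := 1) le_rfl).differentiableAt one_ne_zero
  -- (1) the pin bounds the components: `‖G x‖ ≤ 3/2`
  have hGx : ‖G x‖ ≤ 3 / 2 := by
    have h1 := norm_sub_norm_le (G x) Minkowski.bilin
    linarith [Minkowski.norm_bilin_le_one]
  -- (2) the derivative of the Koszul form
  have hdiff : ∀ a b c : E4, DifferentiableAt ℝ (fun y ↦ fderiv ℝ G y a b c) x := fun a b c ↦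
    ((hH.clm_apply (differentiableAt_const a)).clm_apply (differentiableAt_const b)).clm_apply
      (differentiableAt_const c)
  have hK : ∀ A B C V : E4, fderiv ℝ (fun y ↦ OpensChart.koszulForm G y A B C) x V =
      fderiv ℝ (fderiv ℝ G) x V B A C + fderiv ℝ (fderiv ℝ G) x V A C B -
        fderiv ℝ (fderiv ℝ G) x V C B A := by
    intro A B C V
    have hfun : (fun y ↦ OpensChart.koszulForm G y A B C) =
        fun y ↦ fderiv ℝ G y B A C + fderiv ℝ G y A C B - fderiv ℝ G y C B A := by
      funext y
      exact OpensChart.koszulForm_apply G y A B C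
    rw [hfun, fderiv_fun_sub ((hdiff B A C).fun_add (hdiff A C B)) (hdiff C B A),
      fderiv_fun_add (hdiff B A C) (hdiff A C B)]
    simp only [_root_.sub_apply, _root_.add_apply]
    rw [riemBd_fderiv_apply₃ hH, riemBd_fderiv_apply₃ hH, riemBd_fderiv_apply₃ hH]
  have hKb : ∀ A B C V : E4, |fderiv ℝ (fun y ↦ OpensChart.koszulForm G y A B C) x V| ≤
      3 * (L₂ * ‖V‖ * ‖A‖ * ‖B‖ * ‖C‖) := by
    intro A B C V
    rw [hK]
    have e₁ : |fderiv ℝ (fderiv ℝ G) x V B A C| ≤ L₂ * ‖V‖ * ‖A‖ * ‖B‖ * ‖C‖ :=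
      (riemBd_abs_d2_le hL₂ V B A C).trans_eq (by ring)
    have e₂ : |fderiv ℝ (fderiv ℝ G) x V A C B| ≤ L₂ * ‖V‖ * ‖A‖ * ‖B‖ * ‖C‖ :=
      (riemBd_abs_d2_le hL₂ V A C B).trans_eq (by ring)
    have e₃ : |fderiv ℝ (fderiv ℝ G) x V C B A| ≤ L₂ * ‖V‖ * ‖A‖ * ‖B‖ * ‖C‖ :=
      (riemBd_abs_d2_le hL₂ V C B A).trans_eq (by ring)
    calc |fderiv ℝ (fderiv ℝ G) x V B A C + fderiv ℝ (fderiv ℝ G) x V A C B -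
            fderiv ℝ (fderiv ℝ G) x V C B A|
        ≤ |fderiv ℝ (fderiv ℝ G) x V B A C + fderiv ℝ (fderiv ℝ G) x V A C B| +
            |fderiv ℝ (fderiv ℝ G) x V C B A| := abs_sub _ _
      _ ≤ |fderiv ℝ (fderiv ℝ G) x V B A C| + |fderiv ℝ (fderiv ℝ G) x V A C B| +
            |fderiv ℝ (fderiv ℝ G) x V C B A| := by gcongr; exact abs_add_le _ _
      _ ≤ 3 * (L₂ * ‖V‖ * ‖A‖ * ‖B‖ * ‖C‖) := by linarith
  -- (3) the `ΓΓ` pairings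
  have hΓΓ : ∀ A B C D : E4,
      |g.val x (OpensChart.christoffel g G x A B) (OpensChart.christoffel g G x C D)| ≤
        3 / 2 * (LΓ * ‖A‖ * ‖B‖) * (LΓ * ‖C‖ * ‖D‖) := by
    intro A B C D
    rw [hG x, ← Real.norm_eq_abs]
    exact (G x).le_of_opNorm₂_le_of_le hGx (hΓ A B) (hΓ C D)
  -- (4) assemble
  rw [OpensChart.val_riemann_eq hG x X₀ Y₀ Z₀ W₀]
  have hD₁ : |fderiv ℝ (fun y ↦ OpensChart.koszulForm G y Z₀ Y₀ W₀) x X₀| ≤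
      3 * L₂ * (‖X₀‖ * ‖Y₀‖ * ‖Z₀‖ * ‖W₀‖) := (hKb Z₀ Y₀ W₀ X₀).trans_eq (by ring)
  have hD₂ : |fderiv ℝ (fun y ↦ OpensChart.koszulForm G y Z₀ X₀ W₀) x Y₀| ≤
      3 * L₂ * (‖X₀‖ * ‖Y₀‖ * ‖Z₀‖ * ‖W₀‖) := (hKb Z₀ X₀ W₀ Y₀).trans_eq (by ring)
  have hP₁ :
      |g.val x (OpensChart.christoffel g G x Z₀ Y₀) (OpensChart.christoffel g G x W₀ X₀)| ≤
        3 / 2 * LΓ ^ 2 * (‖X₀‖ * ‖Y₀‖ * ‖Z₀‖ * ‖W₀‖) := (hΓΓ Z₀ Y₀ W₀ X₀).trans_eq (by ring)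
  have hP₂ :
      |g.val x (OpensChart.christoffel g G x Z₀ X₀) (OpensChart.christoffel g G x W₀ Y₀)| ≤
        3 / 2 * LΓ ^ 2 * (‖X₀‖ * ‖Y₀‖ * ‖Z₀‖ * ‖W₀‖) := (hΓΓ Z₀ X₀ W₀ Y₀).trans_eq (by ring)
  exact (riemBd_combine hD₁ hD₂ hP₁ hP₂).trans_eq (by ring)

end Summit.FinalStateConjecture.FinalStateConjecture.Theorems.PhotonSphereChannels.TameCensorshipUnwind

end
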